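import Literature.AnabelianGeometry.AbsoluteAnabelian.AbsTopII.CuspidalizationComparison

/-!
# [AbsTopII] Cor 3.7 with the CONTENT of (a): the chain of •'s computes `Π_U ↠ Π_V` (`Cor_3_7′`)

S. Mochizuki, *Topics in Absolute Anabelian Geometry II: Decomposition Groups and Endomorphisms*
[AbsTopII] (bib `MochizukiAbsTopII2013`; locators = PDF pages of the kurims manuscript
`paper:url-585b8d0ad0d9`), §3, Example 3.6 pp. 71–72, Corollary 3.7 pp. 72–73, with [AbsTopI]
(`MochizukiAbsTopI2012`) Def 4.2 (iii) pp. 49–50 (Π-chains, elementary operations).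

Statements file, abc-iut-L4-t6 lineage ([AbsTopII] §3 typer of record), cell abc-iut row
«F-f064-1-REPAIR» (abc-iut-L4-lead RULING #5w (1)).  FINDING F-f064-1 (abc-iut-f-064, kernel
certificates `AbsTopII/BelyiCuspidalizationSchemaScope.lean` p429324 and
`AbsTopII/CuspidalizationComparisonSchemaScope.lean` p429725): the typed Cor 3.7 predicates
`BelyiCurveModel.Cor_3_7` (p405788) and `BelyiModel.Cor_3_7` (p407799) are CONTENT-LIGHT AS TYPED —
both follow from the slimness of `Δ_{U_X}` alone (`cor_3_7_of_isSlimGroup_cuspOf_geom`): the chain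
clause `HasTerminalChainOfType … B.typeChain B.PiV` constrains the TYPE-chain and the term `Π_V`, but
nothing ties the chain to the output `Π_U ↠ Π_V`, so the identity chain `Π ⇝ Π ⇝ Π ⇝ Π ⇝ Π` of type
`⋏, ⋎, ⋏, ⋎` with `Π_V := Π`, `Π_U := Π_{U_X}` is a witness.  What print says (Cor 3.7 (a) p. 73):

> "(a) For some normal open subgroup `Π_V ⊆ Π` […] there exists a [not necessarily unique]
> `Π`-chain, which admits an entirely “group-theoretic” description, with associated type-chain
> `⋏, ⋎, •, …, •, ⋏, •, …, •, ⋎` — cf. Example 3.6, (ii) — that admits a terminal isomorphism with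
> the trivial `Π`-chain [of length 0] such that if we write `U := V ×_X U_X`,
> `Π_U := Π_V ×_Π Π_{U_X}`, then the natural surjection `Π_U ↠ Π_V` may be recovered from the chain
> of “•’s” terminating at the second to last group of the above-mentioned `Π`-chain."

i.e. (Example 3.6 (i)/(ii) pp. 71–72: `… ⇝ W ⇝ W_n ⇝ ⋯ ⇝ W_1 = U ⇝ U_m ⇝ ⋯ ⇝ U_1 = V ⇝ X`) the
second block of de-cuspidalizations runs from a term `≅ Π_U` to the second-to-last term `≅ Π_V`,
and the COMPOSITE of its operation homomorphisms ([AbsTopI] Def 4.2 (iii)(c): surjections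
`Πⱼ ↠ Πⱼ₊₁` with kernel topologically normally generated by a cuspidal decomposition group) IS
`Π_U ↠ Π_V`.  This file types exactly that conjunct and the repaired predicate:

* `ChainGroup.IsDeCuspVia C L L′ φ` — abc-iut-L4-t4's elementary operation of type • ([AbsTopI]
  Def 4.2 (iii)(c), `ChainGroup.IsElemOp C .deCusp L L′ = ∃ φ, …`) with the operation homomorphism
  `φ` EXPOSED (same clause; the companion's `IsDeCuspVia.isElemOp` recovers t4's);
* `BelyiCuspidalization.RealizesChain B C hP hΔ hne` — "there exists a `Π`-chain `c` of the
  recorded type-chain with a terminal isomorphism to the trivial chain, terms `Π_s ≅ Π_U`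
  (`= B.cuspU`) and `Π_t ≅ Π_V` (`= B.PiV`), `t` the second-to-last index, `t − s = n + m` (the
  length of the •-tail of Ex 3.6 (i)), both isomorphisms over `G` up to an inner automorphism, and
  operation homomorphisms `φⱼ : Πⱼ ↠ Πⱼ₊₁` of type • for `s ≤ j < t` whose composite, read through
  the two isomorphisms, is `Π_U ↠ Π_V`";
* `BelyiModel.Cor_3_7′` — `BelyiModel.Cor_3_7` (printed generality over a class `𝒟`, abc-iut-L4-t13's
  `ConstructionDataClass`) with `HasTerminalChainOfType …` replaced by `RealizesChain …`.
Statements only (3 predicates); the PROVED links `RealizesChain.hasTerminalChainOfType` and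
`BelyiModel.cor_3_7_of_cor_3_7′ : Cor_3_7′ → Cor_3_7` are the proof-only companion
`AbsTopII/BelyiCuspidalizationContentProofs.lean`.
Not re-typed here: `BelyiCurveModel.Cor_3_7` (p405788; that interface carries no cuspidal data of
`X` itself, which Π-chains need for their • steps — it stays the SHAPE record, as
`AbsTopIII.CurveModel.Thm19aShape` does next to `Thm19a`); Cor 3.8 (`Cor_3_8`, the bi-anabelian
content, unaffected by the finding).
HONEST FRAMING: predicates on a MODEL INTERFACE `(𝒟, M)` the tree does not instantiate (étale `π₁`,
FOUNDATIONS row 12); content-light-as-typed was a statement about OUR typing, not about the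
published corollary; typed ≠ proved; nothing here bears on [IUTchIII] Cor 3.12.
-/

noncomputable section

open CategoryTheory Topology
open scoped Pointwise

universe u

namespace Literature.AnabelianGeometry.AbsoluteAnabelian

open Literature.AlgebraicGeometry.Frobenioids (IsSlimGroup)

/-! ### [AbsTopI] Def 4.2 (iii)(c) with the operation homomorphism exposed -/

namespace FundamentalExtension.ChainGroup

variable {E : FundamentalExtension.{u}}

/-- [AbsTopI] Def 4.2 (iii)(c), type •, FOR A GIVEN operation homomorphism `φ : Πⱼ ↠ Πⱼ₊₁`: "a
surjection of profinite groups `φ : Πⱼ ↠ Πⱼ₊₁` [compatible with `ρⱼ, ρⱼ₊₁`], such that `Ker(φ)` is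
topologically normally generated by a cuspidal decomposition group `C` in `Δⱼ` such that `C` is
contained in some normal open torsion-free subgroup of `Δⱼ`" — verbatim the `.deCusp` clause of
abc-iut-L4-t4's `ChainGroup.IsElemOp` (which existentially hides `φ`), relative to cuspidal data `C`
on `Π`. [cite: MochizukiAbsTopI2012, Def 4.2 (iii) p.50] -/
def IsDeCuspVia (C : CuspidalData E) (L L' : E.ChainGroup) (φ : L.grp →ₜ* L'.grp) : Prop :=
  Function.Surjective φ ∧ RigCompat L L' φ ∧
    ∃ D ∈ L.cuspidalDecompGroups C, KerTopNormallyGeneratedBy φ D ∧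
      ∃ N : Subgroup L.grp, N ≤ L.geomJ ∧ (N.subgroupOf L.geomJ).Normal ∧
        IsOpen ((N.subgroupOf L.geomJ : Subgroup L.geomJ) : Set L.geomJ) ∧
        (∀ g : N, IsOfFinOrder g → g = 1) ∧ D ≤ N

end FundamentalExtension.ChainGroup

namespace AbsTopII

open FundamentalExtension
open AbsTopI (ConstructionDataClass)

/-! ### The •-tail of the `Π`-chain computes `Π_U ↠ Π_V` -/

namespace BelyiCuspidalization

variable {E : FundamentalExtension.{u}} (B : BelyiCuspidalization E)

variable (C : CuspidalData E) (hP : IsSlimGroup E.arith) (hΔ : IsSlimGroup E.geom) (hne : E.geom ≠ ⊥)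

/-- **Cor 3.7 (a), the CONTENT of the chain clause** (p. 73; Ex 3.6 (i)(ii) pp. 71–72): "there exists
a [not necessarily unique] `Π`-chain […] with associated type-chain `⋏, ⋎, •, …, •, ⋏, •, …, •, ⋎`
[the output's recorded type-chain, parameters `(l, n, m)`] that admits a terminal isomorphism with the
trivial `Π`-chain [of length 0] such that […] the natural surjection `Π_U ↠ Π_V` may be recovered
from the chain of •’s terminating at the second to last group": a genuine `Π`-chain `c` of
abc-iut-L4-t4 ([AbsTopI] Def 4.2 (iii)) of that type with a terminal isomorphism to the trivial
chain, indices `s ≤ t`, `t` second-to-last, `t − s = n + m` (the block `W ⇝ W_n ⇝ ⋯ ⇝ W_1 = U ⇝ U_m ⇝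
⋯ ⇝ U_1 = V` of Ex 3.6 (i)), isomorphisms `Π_s ≅ Π_U` (the output's `cuspU`) and `Π_t ≅ Π_V` over
`G` up to inner automorphisms, and operation homomorphisms `φⱼ : Πⱼ ↠ Πⱼ₊₁` OF TYPE • for
`s ≤ j < t` whose composite — tracked by the family `ψ` — is, through the two isomorphisms, the
output's `Π_U ↠ Π_V`.  Relative to cuspidal data `C` on `Π` and the slimness inputs of `PiChain`.
[cite: MochizukiAbsTopII2013, Cor 3.7 (a) p.73] -/
def RealizesChain : Prop :=
  ∃ c : E.PiChain C hP hΔ hne,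
    c.typeChain = B.typeChain.map ElementaryOp.toElemOpType ∧
    c.HasTerminalIso (trivialChain C hP hΔ hne) ∧
    ∃ (s t : Fin (c.len + 1)) (_ : s.val + (B.chainParams.2.1 + B.chainParams.2.2) = t.val)
      (_ : t.val + 1 = c.len)
      (eU : B.cuspU.arith ≃ₜ* (c.term s).grp) (eV : ↥B.PiV ≃ₜ* (c.term t).grp) (gU gV : E.gal)
      (ψ : ∀ i : Fin (c.len + 1), B.cuspU.arith →* (c.term i).grp),
      (∀ x, (c.term s).proj (eU x) = MulAut.conj gU (B.projU.gal (B.cuspU.aug x))) ∧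
      (∀ y : B.PiV, (c.term t).proj (eV y) = MulAut.conj gV (E.aug y)) ∧
      (∀ x, ψ s x = eU x) ∧
      (∀ j : Fin c.len, s.val ≤ j.val → j.val < t.val →
        ∃ φ : (c.term j.castSucc).grp →ₜ* (c.term j.succ).grp,
          ChainGroup.IsDeCuspVia C (c.term j.castSucc) (c.term j.succ) φ ∧
            ∀ x, ψ j.succ x = φ (ψ j.castSucc x)) ∧
      (∀ x, ((eV.symm (ψ t x) : ↥B.PiV) : E.arith) = B.projU.arith x)

end BelyiCuspidalization

/-! ### Corollary 3.7 with the content of (a) -/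

namespace BelyiModel

variable {𝒟 : ConstructionDataClass.{u}} (M : BelyiModel 𝒟)

/-- **Corollary 3.7** pp. 72–73 relative to `(𝒟, M)`, WITH THE CONTENT OF (a) (v2 of
`BelyiModel.Cor_3_7`, finding F-f064-1): under "`𝒟` chain-full, rel-isom-DGC" and the standing
hypotheses on the member `X` (`IsCor37Member`), "for every nonempty open subscheme `U_X ⊆ X` defined
over a number field", some `BelyiCuspidalization` of `Π ↠ G` has output isomorphic over `Π` to the
model's `π₁(U_X) ↠ Π` (b), the same images of cuspidal decomposition groups (c), AND (a) "there
exists a `Π`-chain […] with associated type-chain `⋏, ⋎, •, …, •, ⋏, •, …, •, ⋎` […] that admits a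
terminal isomorphism with the trivial `Π`-chain […] such that […] the natural surjection `Π_U ↠ Π_V`
may be recovered from the chain of •’s terminating at the second to last group" — the chain's
•-tail COMPUTES the output's `Π_U ↠ Π_V` (`RealizesChain`).  Supersedes `Cor_3_7` for consumers.
[cite: MochizukiAbsTopII2013, Cor 3.7 pp.72-73] -/
def Cor_3_7' : Prop :=
  𝒟.IsChainFull → 𝒟.RelIsomDGC →
    ∀ (b : 𝒟.Base) (X : (𝒟.datum b).Obj) (h : M.IsCor37Member b X) (U : M.NFOpen b X),
      ∃ B : BelyiCuspidalization ((𝒟.datum b).ext X),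
        B.cusp.IsoOver (M.cuspOf U) ∧
          B.cusp.decompositionImages B.cusps = (M.cuspOf U).decompositionImages (M.cuspsOf U) ∧
          B.RealizesChain (M.cusps b X) h.arith_slim h.geom_slim h.geom_ne_bot

end BelyiModel

end AbsTopII

end Literature.AnabelianGeometry.AbsoluteAnabelian
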